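import Literature.Barriers.AtomisticToContinuum.HalfFillingReflectionPositivityProofs
import Literature.MathematicalPhysics.QuantumLattice.HeisenbergOrderDLSGaussianDomination
import HarnessLib

/-!
# Dyson–Lieb–Simon: the thermal infrared bound for the rotated Heisenberg antiferromagnet

Sibling proof file of `HeisenbergOrder.lean` (item `provefact … dyson_lieb_simon`, step (IR) of
the plan recorded there). No named fact is introduced; everything here is proved.

For the rotated antiferromagnet of unit coupling
`X = Σ_{⟨xy⟩} (-S¹_xS¹_y + S²_xS²_y - S³_xS³_y)` (`dlsHamiltonian`; [DLS1978] proof of Thm. 6.1,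
the Heisenberg antiferromagnet after the rotation by `π` about the `2`-axis on the odd
sublattice) and its Gibbs state at inverse temperature `β` (for coupling `J` read `β ↦ βJ`),
this file proves the finite-volume **infrared bound** for the thermal structure factor of the
first spin component on the even tori of side `L ≥ 4`,

`0 ≤ ĝ_p ≤ 1/(2βE_p) + ½ [(e₃ - e₂)(Σᵢ(1 + cos pᵢ))/E_p]^{1/2}`,  `p ≠ 0`,  `E_p = Σᵢ(1 - cos pᵢ)`

(`dls_infraredBound`), where `e_α` is the site- and direction-averaged nearest-neighbour
correlation `Re⟨S^α_xS^α_{x+eᵢ}⟩_β` of `X`. The operator `X` is the zero-field case of the field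
operator `dlsField L n g` of `HeisenbergOrderDLSGaussianDomination.lean`
(`dlsHamiltonian_eq_dlsField_zero`); Gaussian domination `Z_β(X - V_g + ½Q(g)) ≤ Z_β(X)` is
proved there for `dlsField` (`dls_partitionFn_field_le`, `dlsField_smul`) and transported by that
lemma, the transfer (GD) ⇒ (IR) being first carried out conditionally
(`dls_infraredBound_of_gd`). This is [DLS1978] Thm. 6.1
(`b_p ≤ 1/(2E_{p+Q})` for the Duhamel function, in the rotated frame `p ↦ p + Q`) combined with
the transfer Thms. 3.1–3.2 (Falk–Bruch, weakened by `coth x ≤ 1 + 1/x`) and the double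
commutator of `X` with a wave of the first component; it is the form consumed by the
Kennedy–Lieb–Shastry arrangement of the sum rule ([KLS1988JSP] eqs. (1)–(4)).

## Contents

* a small vocabulary for thermal spin correlations of a Hamiltonian on the torus
  (`gibbsSpinCorr`, `gibbsStructureFactor`, `gibbsBondCorr`) with the state-level identities:
  symmetry, `Re⟨spinBond⟩`, the structure factor through the two Fourier modes
  `C_q = Σ cos(q·x)S¹_x`, `D_q = Σ sin(q·x)S¹_x` (`gibbsStructureFactor_eq_modes`), and the
  **sum rule** `|Λ|⁻¹Σ_q ĝ^α_q (d⁻¹Σᵢcos qᵢ) = e_α` (`gibbsStructureFactor_sumRule`, [KLS1988JSP]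
  eq. (3), finite-volume Parseval form);
* the double commutator `[A,[X,A]] = Σ_{⟨xy⟩}(a_x + a_y)²(S³_xS³_y - S²_xS²_y)` for a wave
  `A = Σ a_uS¹_u` (`lie_lie_dlsHamiltonian`; [DLS1978] eq. (55), [KLS1988JSP] eq. (13)) and its
  Gibbs expectation on the two modes (`re_gibbsState_lie_lie_modes_dls`);
* invariance of `X` and of its Gibbs state under permutations of the coordinate axes, hence
  direction independence of the bond correlations (`sum_gibbsSpinCorr_dls_dir_eq_bondCorr`);
* the transfer (GD) ⇒ (IR) (`dls_infraredBound_of_gd`): `Matrix.gaussianDomination_duhamel_le`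
  ([DLS1978] (44)) and `Matrix.falkBruch_sum_le_of_le` ([DLS1978] Thms. 3.1–3.2); and the
  unconditional bound `dls_infraredBound` from `dls_partitionFn_field_le`.

## References

* [DLS1978] F. J. Dyson, E. H. Lieb, B. Simon, *Phase transitions in quantum spin systems with
  isotropic and nonisotropic interactions*, J. Stat. Phys. 18 (1978) 335–383, Thms. 3.1–3.2,
  4.1–4.2, eq. (44), eq. (55), Thm. 6.1 (read in: E. H. Lieb, *Statistical Mechanics (Selecta)*,
  Springer 2004, paper IV.3).
* [KLS1988JSP] T. Kennedy, E. H. Lieb, B. S. Shastry, *Existence of Néel order in some spin-½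
  Heisenberg antiferromagnets*, J. Stat. Phys. 53 (1988) 1019–1030, eqs. (1)–(4), (12)–(14).
-/

noncomputable section

open Filter Topology Matrix Finset
open Literature.MathematicalPhysics.QuantumLattice Literature.MathematicalPhysics.QuantumLattice.SpinOperators
  Literature.Probability.LatticeModels
open scoped ComplexOrder

-- the commutator Lie-ring structure `⁅a, b⁆ = ab - ba` (Mathlib idiom, enabled locally)
attribute [local instance 100] LieRing.ofAssociativeRing

namespace Literature.MathematicalPhysics.QuantumLattice

variable {d : ℕ}

/-! ### The rotated antiferromagnet of unit coupling -/

section Hamiltonian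

variable {Λ : Type*} [Fintype Λ] [DecidableEq Λ]

/-- The rotated bond term is symmetric (packaging for `Sym2.lift`). [folklore] -/
theorem dlsBond_symm (n : ℕ) (x y : Λ) :
    -spinBond n 0 x y + spinBond n 1 x y - spinBond n 2 x y =
      -spinBond n 0 y x + spinBond n 1 y x - spinBond n 2 y x := by
  simp only [spinBond_comm n _ x y]

end Hamiltonian

/-- **The rotated Heisenberg antiferromagnet (unit coupling)**
`X = Σ_{⟨xy⟩} (-S¹_xS¹_y + S²_xS²_y - S³_xS³_y)` on the torus `(ℤ/Lℤ)^d` (symmetrised bond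
operators): the image of `Σ_{⟨xy⟩} 𝐒_x·𝐒_y` under the rotation by `π` about the `2`-axis on the
odd sublattice of the even torus — "ferromagnetic in the 1 and 3 variables, which have real
representatives, and antiferromagnetic in the 2 variable, which has an imaginary representative".
This is the explicit bond-sum form of the zero-field operator `dlsField L n 0` of
`HeisenbergOrderDLSGaussianDomination.lean` (`dlsHamiltonian_eq_dlsField_zero`); the bond-sum form
is the one on which commutators, matrix elements and lattice symmetries are computed below.
[cite: DLS1978, Thm. 6.1 (proof)] -/
def dlsHamiltonian (d L : ℕ) [NeZero L] (n : ℕ) : Op (TorusSite d L) (n + 1) :=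
  ∑ e ∈ (torusGraph d L).edgeFinset,
    Sym2.lift ⟨fun x y => -spinBond n 0 x y + spinBond n 1 x y - spinBond n 2 x y, dlsBond_symm n⟩ e

/-- `X` is Hermitian. [folklore] -/
theorem dlsHamiltonian_isHermitian (d L : ℕ) [NeZero L] (n : ℕ) :
    (dlsHamiltonian d L n).IsHermitian := by
  unfold dlsHamiltonian
  exact isHermitian_sum_lift _ _ fun x y =>
    ((spinBond_isHermitian n 0 x y).neg.add (spinBond_isHermitian n 1 x y)).sub
      (spinBond_isHermitian n 2 x y)

/-- **`X` is the zero-field operator of the Gaussian-domination file**: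
`dlsHamiltonian d L n = dlsField L n 0` (`= H♭(0) - ΣS³S³`; at zero field the rotated XY bond
`xyRealBond n 0 x y` is `-b⁰ + b¹`). [cite: DLS1978, Thm. 6.1 (proof)] -/
theorem dlsHamiltonian_eq_dlsField_zero (d L : ℕ) [NeZero L] (n : ℕ) :
    dlsHamiltonian d L n = dlsField L n (0 : TorusSite d L → ℝ) := by
  rw [dlsHamiltonian, dlsField, xyRealFieldHamiltonian, torusZZBondSum, ← sum_sub_distrib]
  refine sum_congr rfl fun e _ => ?_
  induction e using Sym2.ind with
  | h x y => simp [xyRealBond]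

/-- The field operator of the Gaussian-domination file as a perturbation of `X`:
`dlsField L n g = X - V_g + ½Q(g)·1` (side `L ≥ 3`). [cite: DLS1978, Thm. 4.2 (eq. (43))] -/
theorem dlsField_eq_dlsHamiltonian_sub_add (L : ℕ) [NeZero L] (hL : 3 ≤ L) (n : ℕ)
    (g : TorusSite d L → ℝ) :
    dlsField L n g = dlsHamiltonian d L n - xyGradField L n g +
      ((xyFieldEnergy L g / 2 : ℝ) : ℂ) • (1 : Op (TorusSite d L) (n + 1)) := by
  have h := dlsField_smul L n hL 1 g
  rw [one_smul, Complex.ofReal_one, one_smul, one_pow, one_mul] at h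
  rw [h, dlsHamiltonian_eq_dlsField_zero]

/-! ### Thermal spin correlations of a Hamiltonian on the torus -/

section Gibbs

variable {L : ℕ} [NeZero L] {n : ℕ}

/-- The thermal `α–α` correlation `G^α(x,y) = Re ⟨S^α_x S^α_y⟩_{β,H}` of a Hamiltonian `H` of
spins `n/2` on the torus. [cite: DLS1978, §1 (8)] -/
def gibbsSpinCorr (β : ℝ) (H : Op (TorusSite d L) (n + 1)) (α : Fin 3) (x y : TorusSite d L) : ℝ :=
  (gibbsState β H (siteSpin n x α * siteSpin n y α)).re

/-- The thermal structure factor `ĝ^α_p = |Λ|⁻¹ Σ_{x,y} cos(p·(x-y)) G^α(x,y)` (`= ⟨Ŝ^α_pŜ^α_{-p}⟩`,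
momenta indexed by the dual torus point `k`, `p = 2πk/L`). [cite: DLS1978, §1 (5), (8)] -/
def gibbsStructureFactor (β : ℝ) (H : Op (TorusSite d L) (n + 1)) (α : Fin 3)
    (k : TorusSite d L) : ℝ :=
  (∑ x : TorusSite d L, ∑ y : TorusSite d L,
      Real.cos (torusPhase L k (x - y)) * gibbsSpinCorr β H α x y) / (L : ℝ) ^ d

/-- The site- and direction-averaged nearest-neighbour correlation
`e_α = (dL^d)⁻¹ Σ_x Σᵢ G^α(x, x + eᵢ)`. [cite: KLS1988JSP, eq. (3)] -/
def gibbsBondCorr (β : ℝ) (H : Op (TorusSite d L) (n + 1)) (α : Fin 3) : ℝ :=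
  (∑ x : TorusSite d L, ∑ i : Fin d, gibbsSpinCorr β H α x (x + Pi.single i 1)) /
    ((d : ℝ) * (L : ℝ) ^ d)

variable (β : ℝ) {H : Op (TorusSite d L) (n + 1)}

/-- The two-point function of a Hermitian Hamiltonian is symmetric, `G^α(x,y) = G^α(y,x)`
(`⟨Aᴴ⟩ = conj ⟨A⟩`). [folklore] -/
theorem gibbsSpinCorr_symm (hH : H.IsHermitian) (α : Fin 3) (x y : TorusSite d L) :
    gibbsSpinCorr β H α x y = gibbsSpinCorr β H α y x := by
  rw [gibbsSpinCorr, gibbsSpinCorr]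
  have h : siteSpin n y α * siteSpin n x α = (siteSpin n x α * siteSpin n y α)ᴴ := by
    rw [conjTranspose_mul, (siteSpin_isHermitian n x α).eq, (siteSpin_isHermitian n y α).eq]
  rw [h, gibbsState_conjTranspose β hH, Complex.star_def, Complex.conj_re]

/-- `Re⟨½(S^α_xS^α_y + S^α_yS^α_x)⟩ = G^α(x,y)`. [folklore] -/
theorem re_gibbsState_spinBond' (hH : H.IsHermitian) (α : Fin 3) (x y : TorusSite d L) :
    (gibbsState β H (spinBond n α x y)).re = gibbsSpinCorr β H α x y := by
  have h : ∀ x y : TorusSite d L,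
      (gibbsState β H (siteSpin n x α * siteSpin n y α)).re = gibbsSpinCorr β H α x y :=
    fun x y => rfl
  rw [spinBond, map_smul, map_add, smul_eq_mul,
    show (1 / 2 : ℂ) = ((1 / 2 : ℝ) : ℂ) by push_cast; ring, Complex.re_ofReal_mul,
    Complex.add_re, h, h, gibbsSpinCorr_symm β hH α y x]
  ring

variable (H)

/-- `⟨A_a B_b⟩ = Σ_{x,y} a_x b_y ⟨S^α_x S^α_y⟩` for real coefficient families (bilinearity of the
Gibbs state). [folklore] -/
theorem gibbsState_wave_mul_wave' (α : Fin 3) (a b : TorusSite d L → ℝ) :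
    gibbsState β H ((∑ x : TorusSite d L, (a x : ℂ) • siteSpin n x α) *
        ∑ y : TorusSite d L, (b y : ℂ) • siteSpin n y α) =
      ∑ x : TorusSite d L, ∑ y : TorusSite d L, ((a x * b y : ℝ) : ℂ) *
        gibbsState β H (siteSpin n x α * siteSpin n y α) := by
  rw [sum_mul_sum, map_sum]
  refine sum_congr rfl fun x _ => ?_
  rw [map_sum]
  refine sum_congr rfl fun y _ => ?_
  rw [smul_mul_assoc, mul_smul_comm, smul_smul, LinearMap.map_smul, smul_eq_mul,
    Complex.ofReal_mul]

/-- **The structure factor through the two modes** (first component):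
`L^d ĝ¹_q = Re⟨C_q²⟩ + Re⟨D_q²⟩`, `C_q = Σ cos(q·x)S¹_x`, `D_q = Σ sin(q·x)S¹_x`
(`cos(q·(x-y)) = cos cos + sin sin`). [cite: DLS1978, §1 (8)] [cite: KLS1988JSP, eq. (12)] -/
theorem gibbsStructureFactor_eq_modes (q : TorusSite d L) :
    gibbsStructureFactor β H 0 q * (L : ℝ) ^ d =
      (gibbsState β H (xyCosMode L n q * xyCosMode L n q)).re +
        (gibbsState β H (xySinMode L n q * xySinMode L n q)).re := by
  have hL : (0 : ℝ) < (L : ℝ) ^ d := by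
    have : (0 : ℝ) < L := by exact_mod_cast Nat.pos_of_ne_zero (NeZero.ne L)
    positivity
  rw [gibbsStructureFactor, div_mul_cancel₀ _ hL.ne', xyCosMode, xySinMode,
    gibbsState_wave_mul_wave', gibbsState_wave_mul_wave', Complex.re_sum, Complex.re_sum,
    ← sum_add_distrib]
  refine sum_congr rfl fun x _ => ?_
  rw [Complex.re_sum, Complex.re_sum, ← sum_add_distrib]
  refine sum_congr rfl fun y _ => ?_
  rw [Complex.re_ofReal_mul, Complex.re_ofReal_mul, gibbsSpinCorr, cos_torusPhase_sub]
  ring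

/-- At zero momentum the structure factor is the volume average of the two-point function.
[cite: DLS1978, §1 (4′)] -/
theorem gibbsStructureFactor_zero_momentum (α : Fin 3) :
    gibbsStructureFactor β H α (0 : TorusSite d L) =
      (∑ x : TorusSite d L, ∑ y : TorusSite d L, gibbsSpinCorr β H α x y) / (L : ℝ) ^ d := by
  simp [gibbsStructureFactor]

variable {H}

/-- `Re⟨C²⟩ ≥ 0` for Hermitian `C` in the Gibbs state of a Hermitian `H` (`C² = CᴴC ≥ 0`).
[folklore] -/
theorem re_gibbsState_mul_self_nonneg' (hH : H.IsHermitian) {C : Op (TorusSite d L) (n + 1)}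
    (hC : C.IsHermitian) : 0 ≤ (gibbsState β H (C * C)).re := by
  have hpsd : (C * C).PosSemidef := by
    simpa only [hC.eq] using posSemidef_conjTranspose_mul_self C
  exact (Complex.nonneg_iff.mp (gibbsState_nonneg_of_posSemidef β hH hpsd)).1

/-- **The sum rule** ([KLS1988JSP] eq. (3), finite-volume Parseval form): for a Hermitian
Hamiltonian on the torus `(ℤ/Lℤ)^d`, `d ≥ 1`,
`|Λ|⁻¹ Σ_q ĝ^α_q (d⁻¹ Σᵢ cos qᵢ) = e_α` (orthogonality of the characters of `(ℤ/Lℤ)^d`,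
`sum_structureFactor_mul_cos`, and the symmetry `G^α(x,y) = G^α(y,x)`).
[cite: KLS1988JSP, eq. (3)] -/
theorem gibbsStructureFactor_sumRule (hH : H.IsHermitian) (hd : 1 ≤ d) (α : Fin 3) :
    (∑ q : TorusSite d L, gibbsStructureFactor β H α q * (torusCosSum L q / d)) / (L : ℝ) ^ d =
      gibbsBondCorr β H α := by
  have hd0 : (d : ℝ) ≠ 0 := by exact_mod_cast (show d ≠ 0 by omega)
  have hL0 : (L : ℝ) ^ d ≠ 0 := by
    have : (L : ℝ) ≠ 0 := by exact_mod_cast NeZero.ne L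
    positivity
  simp_rw [gibbsStructureFactor, torusCosSum, gibbsBondCorr]
  have h : ∀ q : TorusSite d L,
      (∑ x : TorusSite d L, ∑ y : TorusSite d L,
          Real.cos (torusPhase L q (x - y)) * gibbsSpinCorr β H α x y) / (L : ℝ) ^ d *
        ((∑ i : Fin d, Real.cos (latticeMomentum L q i)) / d) =
      (∑ i : Fin d, (∑ x : TorusSite d L, ∑ y : TorusSite d L,
          Real.cos (torusPhase L q (x - y)) * gibbsSpinCorr β H α x y) *
        Real.cos (latticeMomentum L q i)) / ((d : ℝ) * (L : ℝ) ^ d) := by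
    intro q
    rw [div_mul_div_comm, mul_sum, mul_comm ((L : ℝ) ^ d) (d : ℝ)]
  simp_rw [h]
  rw [← sum_div, sum_comm]
  simp_rw [sum_structureFactor_mul_cos L (gibbsSpinCorr β H α) (gibbsSpinCorr_symm β hH α)]
  rw [← mul_sum, sum_comm]
  field_simp

end Gibbs

/-! ### The double commutator `[A, [X, A]]` for a wave `A = Σ_u a_u S¹_u` -/

section DoubleCommutator

variable {Λ : Type*} [Fintype Λ] [DecidableEq Λ]

/-- **The `S³S³` bond double commutator.** For `x ≠ y`, `B = S³_x S³_y` and `A = Σ_u a_u S¹_u`: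
`[A, [B, A]] = -(a_x² + a_y²) S³_x S³_y + 2 a_x a_y S²_x S²_y`.
[cite: DLS1978, eq. (55)] [cite: KLS1988JSP, eq. (13)] -/
theorem lie_lie_bond_zz {n : ℕ} (a : Λ → ℂ) {x y : Λ} (hxy : x ≠ y) :
    ⁅(∑ u : Λ, a u • (siteSpin n u 0 : Op Λ (n + 1))),
      ⁅siteSpin n x 2 * siteSpin n y 2, ∑ u : Λ, a u • (siteSpin n u 0 : Op Λ (n + 1))⁆⁆ =
      -(a x ^ 2 + a y ^ 2) • (siteSpin n x 2 * siteSpin n y 2) +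
        (2 * a x * a y) • (siteSpin n x 1 * siteSpin n y 1) := by
  -- notation
  set X0 : Op Λ (n + 1) := siteSpin n x 0
  set X1 : Op Λ (n + 1) := siteSpin n x 1
  set X2 : Op Λ (n + 1) := siteSpin n x 2
  set Y0 : Op Λ (n + 1) := siteSpin n y 0
  set Y1 : Op Λ (n + 1) := siteSpin n y 1
  set Y2 : Op Λ (n + 1) := siteSpin n y 2
  have hc : ∀ {u v : Λ} (huv : u ≠ v) (α β : Fin 3),
      Commute (siteSpin n u α : Op Λ (n + 1)) (siteSpin n v β) :=
    fun huv α β => siteSpin_commute_of_ne_holds n huv α β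
  -- `[B, S¹_v] = 0` off the bond
  have hB0 : ∀ v, v ≠ x ∧ v ≠ y → ⁅X2 * Y2, (siteSpin n v 0 : Op Λ (n + 1))⁆ = 0 := by
    rintro v ⟨hvx, hvy⟩
    refine Commute.lie_eq ?_
    exact (hc hvx.symm 2 0).mul_left (hc hvy.symm 2 0)
  -- `[B, S¹_x] = i S²_x S³_y`, `[B, S¹_y] = i S³_x S²_y`
  have hBx : ⁅X2 * Y2, X0⁆ = Complex.I • (X1 * Y2) := by
    rw [← lie_skew, lie_mul_of_commute_right X2 (hc hxy 0 2), lie_siteSpin_zero_two,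
      smul_mul_assoc, neg_smul, neg_neg]
  have hBy : ⁅X2 * Y2, Y0⁆ = Complex.I • (X2 * Y1) := by
    rw [← lie_skew, lie_mul_of_commute_left Y2 (hc hxy.symm 0 2), lie_siteSpin_zero_two,
      mul_smul_comm, neg_smul, neg_neg]
  -- `[B, A] = a_x [B, S¹_x] + a_y [B, S¹_y]`
  have hBA : ⁅X2 * Y2, ∑ u : Λ, a u • (siteSpin n u 0 : Op Λ (n + 1))⁆ =
      (Complex.I * a x) • (X1 * Y2) + (Complex.I * a y) • (X2 * Y1) := by
    rw [lie_sum, Fintype.sum_eq_add x y hxy (fun v hv => by rw [lie_smul, hB0 v hv, smul_zero]),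
      lie_smul, lie_smul, hBx, hBy, smul_smul, smul_smul, mul_comm (a x), mul_comm (a y)]
  -- second commutators
  have hx1 : ⁅X0, X1 * Y2⁆ = Complex.I • (X2 * Y2) := by
    rw [lie_mul_of_commute_right X1 (hc hxy 0 2), lie_siteSpin_zero_one, smul_mul_assoc]
  have hx2 : ⁅X0, X2 * Y1⁆ = -Complex.I • (X1 * Y1) := by
    rw [lie_mul_of_commute_right X2 (hc hxy 0 1), lie_siteSpin_zero_two, smul_mul_assoc]
  have hy1 : ⁅Y0, X1 * Y2⁆ = -Complex.I • (X1 * Y1) := by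
    rw [lie_mul_of_commute_left Y2 (hc hxy.symm 0 1), lie_siteSpin_zero_two, mul_smul_comm]
  have hy2 : ⁅Y0, X2 * Y1⁆ = Complex.I • (X2 * Y2) := by
    rw [lie_mul_of_commute_left Y1 (hc hxy.symm 0 2), lie_siteSpin_zero_one, mul_smul_comm]
  have hu0 : ∀ u, u ≠ x ∧ u ≠ y →
      ⁅(siteSpin n u 0 : Op Λ (n + 1)),
        (Complex.I * a x) • (X1 * Y2) + (Complex.I * a y) • (X2 * Y1)⁆ = 0 := by
    rintro u ⟨hux, huy⟩
    refine Commute.lie_eq ?_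
    exact (((hc hux 0 1).mul_right (hc huy 0 2)).smul_right _).add_right
      (((hc hux 0 2).mul_right (hc huy 0 1)).smul_right _)
  have hII : Complex.I * Complex.I = -1 := Complex.I_mul_I
  have hII' : Complex.I * (-Complex.I) = 1 := by rw [mul_neg, Complex.I_mul_I, neg_neg]
  rw [hBA, sum_lie, Fintype.sum_eq_add x y hxy (fun u hu => by rw [smul_lie, hu0 u hu, smul_zero]),
    smul_lie, smul_lie, lie_add, lie_add, lie_smul, lie_smul, lie_smul, lie_smul, hx1, hx2, hy1,
    hy2]
  simp only [smul_smul, smul_add, ← mul_assoc]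
  have e1 : a x * Complex.I * a x * Complex.I = -(a x ^ 2) := by
    linear_combination (a x ^ 2) * hII
  have e2 : a x * Complex.I * a y * -Complex.I = a x * a y := by
    linear_combination (a x * a y) * hII'
  have e3 : a y * Complex.I * a x * -Complex.I = a x * a y := by
    linear_combination (a x * a y) * hII'
  have e4 : a y * Complex.I * a y * Complex.I = -(a y ^ 2) := by
    linear_combination (a y ^ 2) * hII
  rw [e1, e2, e3, e4]
  module

/-- A wave of the first component commutes with every `S¹S¹` bond. [folklore] -/
theorem commute_siteSpin_zero_mul_wave {n : ℕ} (a : Λ → ℂ) (x y : Λ) :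
    Commute (siteSpin n x 0 * siteSpin n y 0 : Op Λ (n + 1))
      (∑ u : Λ, a u • (siteSpin n u 0 : Op Λ (n + 1))) := by
  refine Commute.sum_right _ _ _ fun u _ => Commute.smul_right ?_ _
  have h1 : ∀ z : Λ, Commute (siteSpin n z 0 : Op Λ (n + 1)) (siteSpin n u 0) := by
    intro z
    by_cases hzu : z = u
    · rw [hzu]
    · exact siteSpin_commute_of_ne_holds n hzu 0 0
  exact (h1 x).mul_left (h1 y)

/-- **The rotated bond double commutator.** For `x ≠ y`,
`B♯ = -S¹_xS¹_y + S²_xS²_y - S³_xS³_y` and `A = Σ_u a_u S¹_u`: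
`[A, [B♯, A]] = (a_x + a_y)² (S³_x S³_y - S²_x S²_y)` — the `S¹S¹` part commutes with `A`,
the `S²S²` part is the XY computation `lie_lie_bond`, the `S³S³` part is `lie_lie_bond_zz`.
[cite: DLS1978, eq. (55)] [cite: KLS1988JSP, eq. (13)] -/
theorem lie_lie_dlsBond {n : ℕ} (a : Λ → ℂ) {x y : Λ} (hxy : x ≠ y) :
    ⁅(∑ u : Λ, a u • (siteSpin n u 0 : Op Λ (n + 1))),
      ⁅-(siteSpin n x 0 * siteSpin n y 0) + siteSpin n x 1 * siteSpin n y 1 -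
          siteSpin n x 2 * siteSpin n y 2,
        ∑ u : Λ, a u • (siteSpin n u 0 : Op Λ (n + 1))⁆⁆ =
      -((a x + a y) ^ 2) • (siteSpin n x 1 * siteSpin n y 1) +
        ((a x + a y) ^ 2) • (siteSpin n x 2 * siteSpin n y 2) := by
  have h00 : ⁅(siteSpin n x 0 * siteSpin n y 0 : Op Λ (n + 1)),
      ∑ u : Λ, a u • (siteSpin n u 0 : Op Λ (n + 1))⁆ = 0 :=
    (commute_siteSpin_zero_mul_wave a x y).lie_eq
  have hxy' := lie_lie_bond (n := n) a hxy
  rw [add_lie, h00, zero_add] at hxy'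
  rw [sub_lie, add_lie, neg_lie, h00, neg_zero, zero_add, lie_sub, hxy', lie_lie_bond_zz a hxy]
  module

variable (L : ℕ) [NeZero L] (n : ℕ)

/-- **The double commutator of the rotated antiferromagnet with a wave of the first
component**: `[A, [X, A]] = Σ_{⟨xy⟩} (a_x + a_y)² (S³_xS³_y - S²_xS²_y)` (symmetrised bonds).
[cite: DLS1978, eq. (55)] [cite: KLS1988JSP, eq. (13)] -/
theorem lie_lie_dlsHamiltonian (a : TorusSite d L → ℂ) :
    ⁅(∑ u : TorusSite d L, a u • (siteSpin n u 0 : Op (TorusSite d L) (n + 1))),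
      ⁅dlsHamiltonian d L n,
        ∑ u : TorusSite d L, a u • (siteSpin n u 0 : Op (TorusSite d L) (n + 1))⁆⁆ =
      ∑ e ∈ (torusGraph d L).edgeFinset,
        Sym2.lift ⟨fun x y => -((a x + a y) ^ 2) • spinBond n 1 x y +
          ((a x + a y) ^ 2) • spinBond n 2 x y, fun x y => by
            dsimp only
            rw [spinBond_comm n 1 x y, spinBond_comm n 2 x y, add_comm (a y) (a x)]⟩ e := by
  rw [dlsHamiltonian, sum_lie (torusGraph d L).edgeFinset, lie_sum (torusGraph d L).edgeFinset]
  refine sum_congr rfl fun e he => ?_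
  revert he
  refine Sym2.ind (fun x y => ?_) e
  intro he
  have hxy : x ≠ y := ne_of_mk_mem_edgeFinset he
  simp only [Sym2.lift_mk]
  rw [spinBond_eq_mul_of_ne hxy 0, spinBond_eq_mul_of_ne hxy 1, spinBond_eq_mul_of_ne hxy 2,
    lie_lie_dlsBond a hxy]

variable (β : ℝ)

/-- The Gibbs expectation of the double commutator, edge by edge:
`Re⟨[A,[X,A]]⟩ = Σ_{⟨xy⟩} (a_x + a_y)² (G³(x,y) - G²(x,y))` for a real wave `a`.
[cite: DLS1978, eq. (55)] -/
theorem re_gibbsState_lie_lie_dls (a : TorusSite d L → ℝ) :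
    (gibbsState β (dlsHamiltonian d L n)
      ⁅(∑ u : TorusSite d L, (a u : ℂ) • (siteSpin n u 0 : Op (TorusSite d L) (n + 1))),
        ⁅dlsHamiltonian d L n,
          ∑ u : TorusSite d L, (a u : ℂ) • (siteSpin n u 0 : Op (TorusSite d L) (n + 1))⁆⁆).re =
      ∑ e ∈ (torusGraph d L).edgeFinset,
        Sym2.lift ⟨fun x y => (a x + a y) ^ 2 *
          (gibbsSpinCorr β (dlsHamiltonian d L n) 2 x y -
            gibbsSpinCorr β (dlsHamiltonian d L n) 1 x y), fun x y => by
            dsimp only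
            rw [gibbsSpinCorr_symm β (dlsHamiltonian_isHermitian d L n) 2 x y,
              gibbsSpinCorr_symm β (dlsHamiltonian_isHermitian d L n) 1 x y, add_comm (a y)]⟩ e := by
  rw [lie_lie_dlsHamiltonian, map_sum, Complex.re_sum]
  refine sum_congr rfl fun e _ => ?_
  refine Sym2.ind (fun x y => ?_) e
  simp only [Sym2.lift_mk]
  rw [map_add, LinearMap.map_smul, LinearMap.map_smul, smul_eq_mul, smul_eq_mul, Complex.add_re,
    show -(((a x : ℂ)) + (a y : ℂ)) ^ 2 = ((-((a x + a y) ^ 2) : ℝ) : ℂ) by push_cast; ring,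
    show (((a x : ℂ)) + (a y : ℂ)) ^ 2 = (((a x + a y) ^ 2 : ℝ) : ℂ) by push_cast; ring,
    Complex.re_ofReal_mul, Complex.re_ofReal_mul,
    re_gibbsState_spinBond' β (dlsHamiltonian_isHermitian d L n),
    re_gibbsState_spinBond' β (dlsHamiltonian_isHermitian d L n)]
  ring

/-- **The two modes together**: for side `L ≥ 3`,
`Re⟨[C_q,[X,C_q]]⟩ + Re⟨[D_q,[X,D_q]]⟩ = 2 Σᵢ Σ_z (1 + cos qᵢ)(G³(z,z+eᵢ) - G²(z,z+eᵢ))`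
(`(c_x + c_y)² + (s_x + s_y)² = 2 + 2cos(q·(x-y))`, and each edge of the torus graph is
`{z, z+eᵢ}` for exactly one pair `(z,i)`). [cite: DLS1978, eq. (55) and Thm. 6.1] -/
theorem re_gibbsState_lie_lie_modes_dls (hL : 3 ≤ L) (q : TorusSite d L) :
    (gibbsState β (dlsHamiltonian d L n)
        ⁅xyCosMode L n q, ⁅dlsHamiltonian d L n, xyCosMode L n q⁆⁆).re +
      (gibbsState β (dlsHamiltonian d L n)
        ⁅xySinMode L n q, ⁅dlsHamiltonian d L n, xySinMode L n q⁆⁆).re =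
      2 * ∑ i : Fin d, ∑ z : TorusSite d L,
        (1 + Real.cos (latticeMomentum L q i)) *
          (gibbsSpinCorr β (dlsHamiltonian d L n) 2 z (z + Pi.single i 1) -
            gibbsSpinCorr β (dlsHamiltonian d L n) 1 z (z + Pi.single i 1)) := by
  have hs2 : ∀ x y, gibbsSpinCorr β (dlsHamiltonian d L n) 1 x y =
      gibbsSpinCorr β (dlsHamiltonian d L n) 1 y x :=
    gibbsSpinCorr_symm β (dlsHamiltonian_isHermitian d L n) 1
  have hs3 : ∀ x y, gibbsSpinCorr β (dlsHamiltonian d L n) 2 x y =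
      gibbsSpinCorr β (dlsHamiltonian d L n) 2 y x :=
    gibbsSpinCorr_symm β (dlsHamiltonian_isHermitian d L n) 2
  rw [xyCosMode, xySinMode, re_gibbsState_lie_lie_dls, re_gibbsState_lie_lie_dls, ← sum_add_distrib]
  have hcomb : ∀ e ∈ (torusGraph d L).edgeFinset,
      Sym2.lift ⟨fun x y => (Real.cos (torusPhase L q x) + Real.cos (torusPhase L q y)) ^ 2 *
          (gibbsSpinCorr β (dlsHamiltonian d L n) 2 x y - gibbsSpinCorr β (dlsHamiltonian d L n) 1 x y),
          fun x y => by
            dsimp only; rw [hs3 x y, hs2 x y, add_comm (Real.cos (torusPhase L q y))]⟩ e +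
        Sym2.lift ⟨fun x y => (Real.sin (torusPhase L q x) + Real.sin (torusPhase L q y)) ^ 2 *
          (gibbsSpinCorr β (dlsHamiltonian d L n) 2 x y - gibbsSpinCorr β (dlsHamiltonian d L n) 1 x y),
          fun x y => by
            dsimp only; rw [hs3 x y, hs2 x y, add_comm (Real.sin (torusPhase L q y))]⟩ e =
      2 * Sym2.lift ⟨fun x y => (1 + Real.cos (torusPhase L q (x - y))) *
          (gibbsSpinCorr β (dlsHamiltonian d L n) 2 x y - gibbsSpinCorr β (dlsHamiltonian d L n) 1 x y),
          fun x y => by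
            dsimp only
            rw [hs3 x y, hs2 x y, cos_torusPhase_sub, cos_torusPhase_sub]; ring⟩ e := by
    intro e _
    refine Sym2.ind (fun x y => ?_) e
    simp only [Sym2.lift_mk]
    rw [cos_torusPhase_sub]
    linear_combination (gibbsSpinCorr β (dlsHamiltonian d L n) 2 x y -
        gibbsSpinCorr β (dlsHamiltonian d L n) 1 x y) * Real.cos_sq_add_sin_sq (torusPhase L q x) +
      (gibbsSpinCorr β (dlsHamiltonian d L n) 2 x y -
        gibbsSpinCorr β (dlsHamiltonian d L n) 1 x y) * Real.cos_sq_add_sin_sq (torusPhase L q y)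
  rw [sum_congr rfl hcomb, ← mul_sum]
  congr 1
  have hpairs := sum_pairs_eq_sum_edgeFinset (d := d) L (by omega)
    (Sym2.lift ⟨fun x y => (1 + Real.cos (torusPhase L q (x - y))) *
        (gibbsSpinCorr β (dlsHamiltonian d L n) 2 x y - gibbsSpinCorr β (dlsHamiltonian d L n) 1 x y),
      fun x y => by
        dsimp only
        rw [hs3 x y, hs2 x y, cos_torusPhase_sub, cos_torusPhase_sub]; ring⟩)
  rw [if_neg (by omega), one_mul] at hpairs
  rw [← hpairs, sum_comm]
  refine sum_congr rfl fun i _ => sum_congr rfl fun z _ => ?_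
  simp only [Sym2.lift_mk]
  rw [sub_add_cancel_left, cos_torusPhase_neg_single]

end DoubleCommutator

/-! ### Axis permutations are symmetries of `X` and of its Gibbs state -/

section Symmetry

variable (β : ℝ) (L : ℕ) [NeZero L] (n : ℕ)

/-- **`X` is invariant under permutations of the coordinate axes** (relabelling of sites
`x ↦ x ∘ s`, acting on tensor indices by `σ ↦ σ ∘ π`; the torus graph is invariant).
[folklore] -/
theorem dlsHamiltonian_submatrix_comp_perm (s : Equiv.Perm (Fin d)) :
    (dlsHamiltonian d L n).submatrix
        (fun σ : TensorIndex (TorusSite d L) (n + 1) =>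
          σ ∘ (Equiv.arrowCongr s.symm (Equiv.refl (ZMod L))))
        (fun σ => σ ∘ (Equiv.arrowCongr s.symm (Equiv.refl (ZMod L)))) =
      dlsHamiltonian d L n := by
  set π : TorusSite d L ≃ TorusSite d L := Equiv.arrowCongr s.symm (Equiv.refl (ZMod L)) with hπ
  rw [dlsHamiltonian, submatrix_finset_sum]
  refine Finset.sum_nbij' (Sym2.map π) (Sym2.map π.symm) (fun e he => ?_) (fun e he => ?_)
    (fun e _ => ?_) (fun e _ => ?_) (fun e _ => ?_)
  · exact (map_comp_perm_mem_edgeFinset L s e).2 he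
  · exact (map_comp_perm_mem_edgeFinset L s.symm e).2 he
  · simp only [Sym2.map_map, Equiv.symm_comp_self, Sym2.map_id', id_eq]
  · simp only [Sym2.map_map, Equiv.self_comp_symm, Sym2.map_id', id_eq]
  · induction e using Sym2.ind with
    | h x y =>
      simp only [Sym2.map_mk, Sym2.lift_mk, submatrix_add, submatrix_sub, submatrix_neg,
        Pi.add_apply, Pi.sub_apply, Pi.neg_apply, spinBond_submatrix_comp]

/-- The thermal two-point function of `X` is invariant under permutations of the coordinate
axes: `G^α(x ∘ s, y ∘ s) = G^α(x, y)`. [folklore] -/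
theorem gibbsSpinCorr_dls_comp_perm (s : Equiv.Perm (Fin d)) (α : Fin 3) (x y : TorusSite d L) :
    gibbsSpinCorr β (dlsHamiltonian d L n) α (x ∘ s) (y ∘ s) =
      gibbsSpinCorr β (dlsHamiltonian d L n) α x y := by
  rw [gibbsSpinCorr, gibbsSpinCorr, ← arrowCongr_symm_apply L s x,
    ← arrowCongr_symm_apply L s y, ← siteSpin_submatrix_comp n _ x α,
    ← siteSpin_submatrix_comp n _ y α,
    ← Matrix.submatrix_mul _ _ _ _ _ (bijective_comp_equiv (q := n + 1) _),
    Literature.Barriers.AtomisticToContinuum.BoseGas.gibbsState_submatrix_comp _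
      (dlsHamiltonian_submatrix_comp_perm L n s) β]

/-- Direction independence of the thermal nearest-neighbour correlations of `X`:
`Σ_z G^α(z, z + eᵢ) = Σ_z G^α(z, z + eⱼ)` (transposition of the axes `i`, `j`).
[cite: KLS1988JSP, eq. (3)] -/
theorem sum_gibbsSpinCorr_dls_dir_eq (α : Fin 3) (i j : Fin d) :
    ∑ z : TorusSite d L, gibbsSpinCorr β (dlsHamiltonian d L n) α z (z + Pi.single i 1) =
      ∑ z : TorusSite d L, gibbsSpinCorr β (dlsHamiltonian d L n) α z (z + Pi.single j 1) := by
  have hsi : (Equiv.swap i j).symm i = j := by rw [Equiv.symm_swap, Equiv.swap_apply_left]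
  calc ∑ z : TorusSite d L, gibbsSpinCorr β (dlsHamiltonian d L n) α z (z + Pi.single i 1)
      = ∑ z : TorusSite d L, gibbsSpinCorr β (dlsHamiltonian d L n) α (z ∘ Equiv.swap i j)
          ((z ∘ Equiv.swap i j : TorusSite d L) + Pi.single j 1) :=
        sum_congr rfl fun z _ => by
          rw [← gibbsSpinCorr_dls_comp_perm β L n (Equiv.swap i j) α z, add_single_comp_perm, hsi]
    _ = ∑ z : TorusSite d L, gibbsSpinCorr β (dlsHamiltonian d L n) α z (z + Pi.single j 1) :=
        (Equiv.arrowCongr (Equiv.swap i j).symm (Equiv.refl (ZMod L))).sum_comp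
          (fun z => gibbsSpinCorr β (dlsHamiltonian d L n) α z (z + Pi.single j 1))

/-- **Direction independence of the bond average**: `Σ_z G^α(z, z+eᵢ) = L^d e_α` for every
direction `i`. [cite: KLS1988JSP, eq. (3)] -/
theorem sum_gibbsSpinCorr_dls_dir_eq_bondCorr (hd : 0 < d) (α : Fin 3) (i : Fin d) :
    ∑ z : TorusSite d L, gibbsSpinCorr β (dlsHamiltonian d L n) α z (z + Pi.single i 1) =
      gibbsBondCorr β (dlsHamiltonian d L n) α * (L : ℝ) ^ d := by
  have hL : (0 : ℝ) < (L : ℝ) ^ d := by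
    have : (0 : ℝ) < L := by exact_mod_cast Nat.pos_of_ne_zero (NeZero.ne L)
    positivity
  have hd' : (0 : ℝ) < d := by exact_mod_cast hd
  rw [gibbsBondCorr, sum_comm,
    sum_congr rfl fun j _ => sum_gibbsSpinCorr_dls_dir_eq β L n α j i, sum_const, card_univ,
    Fintype.card_fin, nsmul_eq_mul]
  field_simp

end Symmetry

/-! ### (GD) ⇒ (IR) in finite volume -/

section Infrared

variable (L : ℕ) [NeZero L] (n : ℕ)

/-- **Thermal Gaussian domination ⇒ the infrared bound, in finite volume** ([DLS1978] Thm. 6.1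
with Thms. 3.1–3.2, in the rotated frame). For `d ≥ 1`, side `L ≥ 3`, `β > 0` and a momentum
`q ≠ 0` of the dual torus: if `Z_β(X - V_g + ½Q(g)) ≤ Z_β(X)` for every real field `g`
(`V_g = Σ(g_x - g_{x+eᵢ})(S¹_x - S¹_{x+eᵢ})`, `Q(g) = Σ(g_x - g_{x+eᵢ})²`), then
`0 ≤ ĝ¹_q ≤ 1/(2βE_q) + ½[(e₃ - e₂)(d + Σᵢcos qᵢ)/E_q]^{1/2}`, `E_q = Σᵢ(1 - cos qᵢ)`, where
`e_α` are the bond correlations of `X`. Chain: `Matrix.gaussianDomination_duhamel_le`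
([DLS1978] (44)) for the waves `cos(q·)`, `sin(q·)` gives `(C,C) + (D,D) ≤ |Λ|/(2βE_q)`; the
Falk–Bruch transfer `Matrix.falkBruch_sum_le_of_le` ([DLS1978] Thms. 3.1–3.2); the double
commutator `re_gibbsState_lie_lie_modes_dls` and direction independence.
[cite: DLS1978, Thms. 3.1–3.2, eq. (44), Thm. 6.1] [cite: KLS1988JSP, eq. (1)] -/
theorem dls_infraredBound_of_gd (hL : 3 ≤ L) (hd : 0 < d) {β : ℝ} (hβ : 0 < β)
    (hGD : ∀ g : TorusSite d L → ℝ,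
      (partitionFn β (dlsHamiltonian d L n - xyGradField L n g +
        ((xyFieldEnergy L g / 2 : ℝ) : ℂ) • 1)).re ≤ (partitionFn β (dlsHamiltonian d L n)).re)
    (q : TorusSite d L) (hq : q ≠ 0) :
    0 ≤ gibbsStructureFactor β (dlsHamiltonian d L n) 0 q ∧
      gibbsStructureFactor β (dlsHamiltonian d L n) 0 q ≤
        1 / (2 * β * dispersion (latticeMomentum L q)) +
          1 / 2 * Real.sqrt ((gibbsBondCorr β (dlsHamiltonian d L n) 2 -
              gibbsBondCorr β (dlsHamiltonian d L n) 1) * (d + torusCosSum L q) /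
            dispersion (latticeMomentum L q)) := by
  -- notation
  set H : Op (TorusSite d L) (n + 1) := dlsHamiltonian d L n with hH_def
  have hH : H.IsHermitian := dlsHamiltonian_isHermitian d L n
  set E : ℝ := dispersion (latticeMomentum L q) with hE_def
  have hE : 0 < E := dispersion_latticeMomentum_pos hq
  set C : Op (TorusSite d L) (n + 1) := xyCosMode L n q with hC_def
  set D : Op (TorusSite d L) (n + 1) := xySinMode L n q with hD_def
  have hC : C.IsHermitian := xyCosMode_isHermitian L n q
  have hD : D.IsHermitian := xySinMode_isHermitian L n q
  have hLd : 0 < (L : ℝ) ^ d := by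
    have : (0 : ℝ) < L := by exact_mod_cast Nat.pos_of_ne_zero (NeZero.ne L)
    positivity
  set t : ℝ := gibbsBondCorr β H 2 - gibbsBondCorr β H 1 with ht_def
  -- (1) the Duhamel infrared bound `(V_g, V_g) ≤ Q(g)/β` from Gaussian domination
  have hDuh : ∀ g : TorusSite d L → ℝ,
      (duhamel β H (xyGradField L n g) (xyGradField L n g)).re ≤ xyFieldEnergy L g / β := by
    intro g
    refine gaussianDomination_duhamel_le_holds _ β hβ H (xyGradField L n g) hH
      (xyGradField_isHermitian L n g) (xyFieldEnergy L g) (fun s => ?_)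
    have := hGD (s • g)
    rwa [xyGradField_smul, xyFieldEnergy_smul] at this
  -- (2) the two modes: `(C,C) + (D,D) ≤ |Λ|/(2βE)`
  set b₀ : ℝ := (L : ℝ) ^ d / (2 * β * E) with hb₀_def
  have hb₀ : 0 ≤ b₀ := by positivity
  have hmode : ∀ {W : Op (TorusSite d L) (n + 1)} {g : TorusSite d L → ℝ},
      xyGradField L n g = ((2 * E : ℝ) : ℂ) • W →
        (2 * E) ^ 2 * (duhamel β H W W).re ≤ xyFieldEnergy L g / β := by
    intro W g hVg
    have h1 := hDuh g
    rw [hVg, Literature.Barriers.AtomisticToContinuum.BoseGas.duhamel_smul_smul,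
      show ((2 * E : ℝ) : ℂ) * ((2 * E : ℝ) : ℂ) = (((2 * E) ^ 2 : ℝ) : ℂ) by push_cast; ring,
      Complex.re_ofReal_mul] at h1
    exact h1
  have hb : (duhamel β H C C).re + (duhamel β H D D).re ≤ b₀ := by
    have h1 := hmode (xyGradField_cos L n q)
    have h2 := hmode (xyGradField_sin L n q)
    have hQ := xyFieldEnergy_cos_add_sin L q
    rw [← hE_def] at hQ
    have hsum : (2 * E) ^ 2 * ((duhamel β H C C).re + (duhamel β H D D).re) ≤
        2 * E * (L : ℝ) ^ d / β := by
      rw [mul_add, ← hQ, add_div]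
      exact add_le_add h1 h2
    rw [hb₀_def, le_div_iff₀ (by positivity)]
    rw [le_div_iff₀ hβ] at hsum
    nlinarith [hsum, hE]
  -- (3) Falk–Bruch for the pair `(C, D)`
  have hA : ∀ k : Fin 2, ((![C, D] : Fin 2 → Op (TorusSite d L) (n + 1)) k).IsHermitian := by
    intro k
    fin_cases k
    · exact hC
    · exact hD
  have hFB := falkBruch_sum_le_of_le hH hβ.le hA (b₀ := b₀)
    (by simpa only [Fin.sum_univ_two, Matrix.cons_val_zero, Matrix.cons_val_one] using hb)
  simp only [Fin.sum_univ_two, Matrix.cons_val_zero, Matrix.cons_val_one] at hFB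
  -- (4) the two sides: `|Λ| ĝ` and the double commutator
  have hlhs : gibbsStructureFactor β H 0 q * (L : ℝ) ^ d =
      (gibbsState β H (C * C)).re + (gibbsState β H (D * D)).re :=
    gibbsStructureFactor_eq_modes β H q
  set c : ℝ := (gibbsState β H (C * (H * C - C * H) - (H * C - C * H) * C)).re +
    (gibbsState β H (D * (H * D - D * H) - (H * D - D * H) * D)).re with hc_def
  have hc0 : 0 ≤ c := add_nonneg (hH.re_gibbsState_doubleComm_nonneg hC hβ.le)
    (hH.re_gibbsState_doubleComm_nonneg hD hβ.le)
  have hceq : c = (L : ℝ) ^ d * (2 * (t * (d + torusCosSum L q))) := by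
    have h1 := re_gibbsState_lie_lie_modes_dls L n β hL q  -- (L, n, β) order
    have hdir : 2 * ∑ i : Fin d, ∑ z : TorusSite d L,
        (1 + Real.cos (latticeMomentum L q i)) *
          (gibbsSpinCorr β H 2 z (z + Pi.single i 1) - gibbsSpinCorr β H 1 z (z + Pi.single i 1)) =
        (L : ℝ) ^ d * (2 * (t * (d + torusCosSum L q))) := by
      rw [← sum_one_add_cos_latticeMomentum L q, mul_sum, mul_sum, mul_sum, mul_sum]
      refine sum_congr rfl fun i _ => ?_
      rw [← mul_sum, sum_sub_distrib, sum_gibbsSpinCorr_dls_dir_eq_bondCorr β L n hd 2 i,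
        sum_gibbsSpinCorr_dls_dir_eq_bondCorr β L n hd 1 i, ht_def]
      ring
    rw [hdir] at h1
    rw [hc_def, ← h1]
    rfl
  -- (5) positivity of `ĝ`
  have haC : 0 ≤ (gibbsState β H (C * C)).re := re_gibbsState_mul_self_nonneg' β hH hC
  have haD : 0 ≤ (gibbsState β H (D * D)).re := re_gibbsState_mul_self_nonneg' β hH hD
  have hg0 : 0 ≤ gibbsStructureFactor β H 0 q := by
    have h0 : 0 ≤ gibbsStructureFactor β H 0 q * (L : ℝ) ^ d := by
      rw [hlhs]; exact add_nonneg haC haD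
    exact nonneg_of_mul_nonneg_left h0 hLd
  refine ⟨hg0, ?_⟩
  -- the radicand is nonnegative
  have htC : 0 ≤ t * (d + torusCosSum L q) := by
    have h2 : 0 ≤ (L : ℝ) ^ d * (2 * (t * (d + torusCosSum L q))) := by rw [← hceq]; exact hc0
    nlinarith [h2, hLd]
  -- (6) assemble: `|Λ|ĝ ≤ b₀ + ½√(βb₀c) = b₀ + ½ |Λ| √(t(d + C_q)/E)`
  have hsqrt : Real.sqrt (β * b₀ * c) = (L : ℝ) ^ d * Real.sqrt (t * (d + torusCosSum L q) / E) := by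
    have h1 : β * b₀ * c = ((L : ℝ) ^ d) ^ 2 * (t * (d + torusCosSum L q) / E) := by
      rw [hceq, hb₀_def]
      field_simp
    rw [h1, Real.sqrt_mul (sq_nonneg _), Real.sqrt_sq hLd.le]
  have hmain : gibbsStructureFactor β H 0 q * (L : ℝ) ^ d ≤
      b₀ + 1 / 2 * ((L : ℝ) ^ d * Real.sqrt (t * (d + torusCosSum L q) / E)) := by
    rw [hlhs, ← hsqrt]
    exact hFB
  have hb₀' : b₀ = (L : ℝ) ^ d * (1 / (2 * β * E)) := by rw [hb₀_def]; ring
  rw [hb₀'] at hmain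
  have hfin : gibbsStructureFactor β H 0 q * (L : ℝ) ^ d ≤
      (1 / (2 * β * E) + 1 / 2 * Real.sqrt (t * (d + torusCosSum L q) / E)) * (L : ℝ) ^ d := by
    calc gibbsStructureFactor β H 0 q * (L : ℝ) ^ d
        ≤ (L : ℝ) ^ d * (1 / (2 * β * E)) +
            1 / 2 * ((L : ℝ) ^ d * Real.sqrt (t * (d + torusCosSum L q) / E)) := hmain
      _ = (1 / (2 * β * E) + 1 / 2 * Real.sqrt (t * (d + torusCosSum L q) / E)) * (L : ℝ) ^ d := by
          ring
  exact le_of_mul_le_mul_right hfin hLd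

/-- **The thermal infrared bound for the rotated antiferromagnet** ([DLS1978] Thm. 6.1 with
Thms. 3.1–3.2 and 4.2, in the rotated frame and the weakened Falk–Bruch form): on the even torus
`(ℤ/2kℤ)^d`, `k ≥ 2`, `d ≥ 1`, for every `β > 0`, spin `n/2` and momentum `q ≠ 0`,
`0 ≤ ĝ¹_q ≤ 1/(2βE_q) + ½[(e₃ - e₂)(d + Σᵢcos qᵢ)/E_q]^{1/2}` in the Gibbs state of `X` —
Gaussian domination being the theorem `dls_partitionFn_field_le` of
`HeisenbergOrderDLSGaussianDomination.lean`, transported through `dlsHamiltonian_eq_dlsField_zero`.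
[cite: DLS1978, Thms. 3.1–3.2, 4.2, eq. (44), Thm. 6.1] [cite: KLS1988JSP, eq. (1)] -/
theorem dls_infraredBound (k : ℕ) [NeZero (2 * k)] (hk : 2 ≤ k) (hd : 0 < d) {β : ℝ} (hβ : 0 < β)
    (q : TorusSite d (2 * k)) (hq : q ≠ 0) :
    0 ≤ gibbsStructureFactor β (dlsHamiltonian d (2 * k) n) 0 q ∧
      gibbsStructureFactor β (dlsHamiltonian d (2 * k) n) 0 q ≤
        1 / (2 * β * dispersion (latticeMomentum (2 * k) q)) +
          1 / 2 * Real.sqrt ((gibbsBondCorr β (dlsHamiltonian d (2 * k) n) 2 -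
              gibbsBondCorr β (dlsHamiltonian d (2 * k) n) 1) * (d + torusCosSum (2 * k) q) /
            dispersion (latticeMomentum (2 * k) q)) := by
  refine dls_infraredBound_of_gd (2 * k) n (by omega) hd hβ (fun g => ?_) q hq
  rw [← dlsField_eq_dlsHamiltonian_sub_add (2 * k) (by omega) n g, dlsHamiltonian_eq_dlsField_zero]
  exact dls_partitionFn_field_le (2 * k) n (even_two_mul k) (by omega) hβ g

end Infrared

end Literature.MathematicalPhysics.QuantumLattice
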